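import Mathlib
import HarnessLib
import Summits.AtomisticToContinuum.FouriersLaw.Statement
import Summits.AtomisticToContinuum.FouriersLaw.Theses.MatthiessenLadder
import Summits.AtomisticToContinuum.FouriersLaw.Theses.JunctionLocality
import Summits.AtomisticToContinuum.FouriersLaw.Theses.BoundaryEscapeDeficit
import Summits.AtomisticToContinuum.FouriersLaw.Theorems.MatthiessenLadderIncrementGlue
import Summits.AtomisticToContinuum.FouriersLaw.Theorems.MatthiessenLadderLimitGlue
import Summits.AtomisticToContinuum.FouriersLaw.Theorems.MatthiessenLadderPrefixSteadyStates
import Summits.AtomisticToContinuum.FouriersLaw.Theorems.OddSectorIrreversibilityBoundedResponseConvergesSplit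
import Summits.AtomisticToContinuum.FouriersLaw.Theorems.BondHeatUncertaintyPositiveOrInfiniteLimitSlots
import Summits.AtomisticToContinuum.FouriersLaw.Theorems.BondHeatUncertaintyPositiveOrInfiniteLimitSplit
import Summits.AtomisticToContinuum.FouriersLaw.Theorems.JunctionLocalitySuperadditiveResistanceStubLinearResponsePlain
import Literature.Barriers.AtomisticToContinuum.FixedLengthNoConductivityControl

/-!
# Redirect strategist r1 — `PrefixIncrementBounds` (stmt-AtomisticToContinuum-12776) is Fourier's law in
# Matthiessen costume, modulo the bare non-oscillation atom

Crux (rank 2, deciding crux of route `MatthiessenLadder`, decl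
`Summit.AtomisticToContinuum.FouriersLaw.Theses.MatthiessenLadder.PrefixIncrementBounds`, PIB): `N`-uniform
two-sided bounds `-r_max ≤ ΔR ≤ r_max` always and `ΔR ≥ r_min > 0` in the bulk on the resistance increment
`ΔR = (N-1)/D₁ - (N-1)/D₀` when the harmonic/anharmonic interface of the prefix cell chain `cellChain (· < k)`
moves right by one cell, at fixed size `N` and temperature `T`.

This file (sorry-free, standard axioms) PLACES the crux against the sub-problem Statement `FouriersLaw` by name:

* `boundedResponse_of_prefixIncrementBounds : PIB → BoundedResponse` — the LOWER increments telescope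
  (landed `incrementGlue_proof`, item 12780) over the PROVED frame `PrefixSteadyStates_of` (item 12778) to the
  catalogued necessary waypoint `BoundedResponse` (item 10924 = `HasBoundedResponse (pinnedChain …)` under
  uniqueness, `Literature/Barriers/AtomisticToContinuum/FixedLengthNoConductivityControl.lean`: "Nothing is known
  about the dependence of `D` on `L`", BLR2000 §6.3) — the bounded-conductivity half of Fourier's law.
* `conductanceLowerBound_of_prefixIncrementBounds : PIB → JunctionLocality.ConductanceLowerBound` — NEW here: the
  UPPER increments telescope from the solved harmonic base `R_N^{(0)} = 1/fluxCoeff ω₂ γ N ≤ 2/fluxLimit ω₂ γ`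
  to `(N-1)/D_N ≤ 2/fluxLimit + N·r_max`, i.e. the Ohmic floor `D_N ≥ 1/(2(2/fluxLimit + r_max))` (item 11749,
  the no-insulator half of Fourier's law, crux of route `JunctionLocality`).
* `fouriersLaw_of_prefixIncrementBounds_of_escapeNonOscillation : PIB → EscapeNonOscillation → FouriersLaw` —
  with the bare `EReal`-regularity atom `EscapeNonOscillation` (item 12238: `N ↦ (N-1)γE_N` has a limit in
  `[-∞, ∞]`, no value claimed) the crux ALONE closes the sub-problem: the route's `closes` fed with the landed
  `incrementGlue_proof`, `PrefixSteadyStates_of`, `NessUnique_holds`, `FiniteResponseOfUnique_holds` and the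
  landed split glue `boundedResponseConverges_of_subs` (12238 ∧ 11749 ⇒ 9141) applied to the floor above.
* `pinnedContent_of_fouriersLaw : FouriersLaw → BoundedResponse ∧ ConductanceLowerBound ∧ EscapeNonOscillation` —
  conversely the Statement gives back everything PIB says about the conjunct's chain (landed bridges
  `hasBoundedResponse_of_fouriersLawFor`, `positiveOrInfiniteLimit_of_fouriersLaw`,
  `conductanceLowerBound_of_positiveOrInfiniteLimit`, `escapeNonOscillation_of_positiveOrInfiniteLimit`).

Hence, writing `S = FouriersLaw`, `A = EscapeNonOscillation` (with `S → A`):  `PIB ∧ A → S` and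
`S → (everything PIB asserts about pinnedChain)`.  The part of PIB not returned by `S` is its `N`-uniform control of
the `N - 1` auxiliary MIXED rungs `cellChain (· < k)`, `0 < k < N` — extra obligations, not a weakening.  So the
crux is not strictly weaker than the summit: it carries BOTH quantitative halves of Fourier's law for the pinned
anharmonic chain (bounded conductivity AND Ohmic floor), and what separates it from `S` is only the bare
regularity atom 12238 on one side and foreign (mixed-chain) obligations on the other.
-/

noncomputable section

namespace Summit.AtomisticToContinuum.FouriersLaw.Cruxes.PrefixIncrementBounds.StrategyCensusR1

open MeasureTheory Filter Topology
open Literature.MathematicalPhysics.KineticTheory.HeatConduction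
open Summit.AtomisticToContinuum.FouriersLaw.Theses
open Summit.AtomisticToContinuum.FouriersLaw.Theorems

/-- **Lower increments ⇒ bounded conductivity.** `PrefixIncrementBounds → BoundedResponse` (item 10924): the landed
telescoping glue `incrementGlue_proof` (item 12780) over the proved frame `PrefixSteadyStates_of` (item 12778).
[folklore] -/
theorem boundedResponse_of_prefixIncrementBounds (h : MatthiessenLadder.PrefixIncrementBounds) :
    MatthiessenLadder.BoundedResponse :=
  incrementGlue_proof h MatthiessenLadderPrefixSteadyStates.PrefixSteadyStates_of

/-- Telescoping with an upper bound on every increment: `R N - R 0 ≤ N • rmax`. [folklore] -/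
theorem telescope_upper {N : ℕ} {rmax : ℝ} (R : ℕ → ℝ) (hup : ∀ k, k < N → R (k + 1) - R k ≤ rmax) :
    R N - R 0 ≤ (N : ℝ) * rmax := by
  rw [← Finset.sum_range_sub]
  calc ∑ k ∈ Finset.range N, (R (k + 1) - R k) ≤ ∑ _k ∈ Finset.range N, rmax :=
        Finset.sum_le_sum fun k hk => hup k (Finset.mem_range.mp hk)
    _ = (N : ℝ) * rmax := by rw [Finset.sum_const, Finset.card_range, nsmul_eq_mul]

/-- **Upper increments ⇒ Ohmic floor.** `PrefixIncrementBounds → JunctionLocality.ConductanceLowerBound` (item 11749):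
telescoping the UPPER increment bounds `ΔR ≤ r_max` from the solved harmonic base `R_N^{(0)} = 1/fluxCoeff ω₂ γ N
≤ 2/fluxLimit ω₂ γ` (`responseCoeff_harmonic_eq`, `one_div_fluxCoeff_le`, harmonic weak-NESS uniqueness from the
proved `PrefixSteadyStates_of` at `k = 0`) gives `(N-1)/D_N ≤ 2/fluxLimit + N·r_max` with `D_N > 0`, hence
`D_N ≥ 1/(2·(2/fluxLimit + r_max))` for `N ≥ max N₀ 2`. [folklore] -/
theorem conductanceLowerBound_of_prefixIncrementBounds (h : MatthiessenLadder.PrefixIncrementBounds) :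
    JunctionLocality.ConductanceLowerBound := by
  intro ω₂ lam β γ hω hl hβ hγ _ μ hμ T hT D hD
  have hPSS := MatthiessenLadderPrefixSteadyStates.PrefixSteadyStates_of ω₂ lam β γ hω hl hβ hγ
  obtain ⟨rmin, rmax, hrmin, hle, k₀, N₀, hinc⟩ := h ω₂ lam β γ hω hl hβ hγ T hT
  have hrmax : 0 < rmax := lt_of_lt_of_le hrmin hle
  -- the given limits are response coefficients of the top rung `cellChain (· < N)` at size `N`
  have hDN : ∀ N : ℕ, (cellChain ω₂ lam β γ (fun i => decide (i < N))).IsResponseCoeff N T (D N) :=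
    fun N => incrementGlue_isResponseCoeff_top (μ N) (hμ N) (hD N)
  -- response coefficients of every rung (PrefixSteadyStates, proved)
  choose E hE using fun k N => (hPSS k).2 N T hT
  obtain ⟨F, hFdef⟩ : ∃ F : ℕ → ℕ → ℝ, F = fun N k : ℕ => if k < N then E k N else D N := ⟨_, rfl⟩
  have hF : ∀ N k : ℕ, k ≤ N →
      (cellChain ω₂ lam β γ (fun i => decide (i < k))).IsResponseCoeff N T (F N k) := by
    intro N k hk
    by_cases hlt : k < N
    · rw [hFdef]
      simp only [if_pos hlt]
      exact hE k N
    · obtain rfl : k = N := le_antisymm hk (not_lt.mp hlt)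
      rw [hFdef]
      simp only [lt_irrefl, if_false]
      exact hDN k
  have hFN : ∀ N : ℕ, F N N = D N := fun N => by rw [hFdef]; simp
  -- the harmonic base `E 0 N = (N-1) · fluxCoeff ω₂ γ N`
  have hE0 : ∀ N : ℕ, E 0 N = ((N : ℝ) - 1) * fluxCoeff ω₂ γ N := by
    intro N
    have huniq : ∀ T_L T_R : ℝ, 0 < T_L → 0 < T_R → ∀ ν : Measure (PhaseSpace N),
        (pinnedChain ω₂ 0 0 γ).IsSteadyState N T_L T_R ν → ν = harmonicNESS ω₂ γ N T_L T_R := by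
      intro T_L T_R h1 h2 ν hν
      obtain ⟨μ₀, -, hu⟩ := (hPSS 0).1 N T_L T_R h1 h2
      rw [MatthiessenLadder.cellChain_lt_zero_isSteadyState] at hu
      rw [hu ν hν, hu _ (isSteadyState_harmonicNESS hω hγ N h1 h2)]
    have h0 := hE 0 N
    rw [MatthiessenLadder.cellChain_lt_zero_isResponseCoeff] at h0
    exact MatthiessenLadder.responseCoeff_harmonic_eq hω hγ hT huniq h0
  -- resistances of the rungs at size `N`
  obtain ⟨R, hRdef⟩ : ∃ R : ℕ → ℕ → ℝ, R = fun N k : ℕ => ((N : ℝ) - 1) / F N k := ⟨_, rfl⟩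
  set B : ℝ := 2 / fluxLimit ω₂ γ with hB
  have hBpos : 0 < B := div_pos two_pos (fluxLimit_pos hω hγ)
  refine ⟨1 / (2 * (B + rmax)), by positivity, max N₀ 2, fun N hN => ?_⟩
  have hN₀ : N₀ ≤ N := le_of_max_le_left hN
  have h2 : 2 ≤ N := le_of_max_le_right hN
  have h2' : (2 : ℝ) ≤ N := by exact_mod_cast h2
  -- every increment is at most `rmax` (PIB, upper half)
  have hup : ∀ k, k < N → R N (k + 1) - R N k ≤ rmax := by
    intro k hk
    rw [hRdef]
    exact (abs_le.mp (hinc N k hN₀ hk (F N k) (F N (k + 1)) (hF N k hk.le)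
      (hF N (k + 1) (Nat.succ_le_of_lt hk))).2.2.1).2
  -- positivity of `D N` (PIB at the last increment)
  have hDpos : 0 < D N := by
    obtain ⟨M, rfl⟩ : ∃ M, N = M + 1 := ⟨N - 1, by omega⟩
    have hpos := (hinc (M + 1) M hN₀ (Nat.lt_succ_self M) (F (M + 1) M) (F (M + 1) (M + 1))
      (hF _ _ (Nat.le_succ M)) (hF _ _ le_rfl)).2.1
    rwa [hFN] at hpos
  -- the harmonic base is bounded: `R N 0 = 1 / fluxCoeff ω₂ γ N ≤ B`
  have hbase : R N 0 ≤ B := by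
    have hF0 : F N 0 = ((N : ℝ) - 1) * fluxCoeff ω₂ γ N := by
      rw [hFdef]
      simp only [if_pos (show 0 < N by omega)]
      exact hE0 N
    rw [hRdef]
    simp only [hF0]
    rw [div_mul_eq_div_div, div_self (by linarith : ((N : ℝ) - 1) ≠ 0)]
    exact JunctionLocality.one_div_fluxCoeff_le hω hγ (by omega)
  -- telescoping: `(N-1)/D N = R N N ≤ B + N rmax`
  have htel := telescope_upper (R N) hup
  have hRNN : R N N = ((N : ℝ) - 1) / D N := by rw [hRdef]; simp only [hFN]
  have hRle : ((N : ℝ) - 1) / D N ≤ B + N * rmax := by rw [← hRNN]; linarith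
  -- hence `D N ≥ (N-1)/(B + N rmax) ≥ 1/(2 (B + rmax))` for `N ≥ 2`
  have h1 : ((N : ℝ) - 1) ≤ (B + N * rmax) * D N := (div_le_iff₀ hDpos).1 hRle
  have hBN : B + N * rmax ≤ 2 * (B + rmax) * ((N : ℝ) - 1) := by nlinarith
  have h3 : ((N : ℝ) - 1) * 1 ≤ ((N : ℝ) - 1) * (2 * (B + rmax) * D N) := by
    nlinarith [mul_le_mul_of_nonneg_right hBN hDpos.le]
  have h4 : 1 ≤ 2 * (B + rmax) * D N := le_of_mul_le_mul_left h3 (by linarith)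
  rw [div_le_iff₀ (by positivity)]
  linarith

/-- **With the bare non-oscillation atom the crux closes the sub-problem.**
`PrefixIncrementBounds → EscapeNonOscillation → _root_.FouriersLaw`: the route's deciding theorem `closes` with every
other binder discharged by LANDED theorems (`incrementGlue_proof` 12780, `PrefixSteadyStates_of` 12778,
`NessUnique_holds` 0741, `FiniteResponseOfUnique_holds` 0717) and the import slot `BoundedResponseConverges`
(9141) supplied by the landed split glue `boundedResponseConverges_of_subs` from item 12238 and the floor
derived from PIB itself. [folklore] -/
theorem fouriersLaw_of_prefixIncrementBounds_of_escapeNonOscillation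
    (h : MatthiessenLadder.PrefixIncrementBounds) (hNO : BoundaryEscapeDeficit.EscapeNonOscillation) :
    _root_.FouriersLaw :=
  MatthiessenLadder.closes incrementGlue_proof h MatthiessenLadderPrefixSteadyStates.PrefixSteadyStates_of
    MatthiessenLadder.NessUnique_holds MatthiessenLadder.FiniteResponseOfUnique_holds
    (boundedResponseConverges_of_subs hNO (conductanceLowerBound_of_prefixIncrementBounds h))

/-- **The Statement returns everything PIB asserts about the conjunct's chain.** `FouriersLaw → BoundedResponse ∧
ConductanceLowerBound ∧ EscapeNonOscillation`, by the landed bridges `hasBoundedResponse_of_fouriersLawFor`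
(Barriers/FixedLengthNoConductivityControl), `positiveOrInfiniteLimit_of_fouriersLaw`,
`conductanceLowerBound_of_positiveOrInfiniteLimit`, `escapeNonOscillation_of_positiveOrInfiniteLimit` (fed with the
proved `NessUnique_holds` and `responseIdentity_proof`). [folklore] -/
theorem pinnedContent_of_fouriersLaw (hF : _root_.FouriersLaw) :
    MatthiessenLadder.BoundedResponse ∧ JunctionLocality.ConductanceLowerBound ∧
      BoundaryEscapeDeficit.EscapeNonOscillation := by
  refine ⟨fun ω₂ lam β γ hω hl hβ hγ _ =>
    Literature.Barriers.AtomisticToContinuum.hasBoundedResponse_of_fouriersLawFor (hF ω₂ lam β γ hω hl hβ hγ), ?_, ?_⟩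
  · exact PositiveOrInfiniteLimit.conductanceLowerBound_of_positiveOrInfiniteLimit
      (PositiveOrInfiniteLimit.positiveOrInfiniteLimit_of_fouriersLaw hF)
  · exact PositiveOrInfiniteLimit.escapeNonOscillation_of_positiveOrInfiniteLimit
      MatthiessenLadder.NessUnique_holds
      Summit.AtomisticToContinuum.FouriersLaw.Cruxes.SuperadditiveResistance.ThermaliseThenCutProbeInsertion.responseIdentity_proof
      (PositiveOrInfiniteLimit.positiveOrInfiniteLimit_of_fouriersLaw hF)

/-- **Summary: modulo the atom `EscapeNonOscillation` (itself a consequence of `FouriersLaw`), the pinned-chain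
content of the crux IS the sub-problem.** [folklore] -/
theorem prefixIncrementBounds_costume :
    (MatthiessenLadder.PrefixIncrementBounds → BoundaryEscapeDeficit.EscapeNonOscillation → _root_.FouriersLaw) ∧
    (_root_.FouriersLaw → BoundaryEscapeDeficit.EscapeNonOscillation) ∧
    (MatthiessenLadder.PrefixIncrementBounds →
      MatthiessenLadder.BoundedResponse ∧ JunctionLocality.ConductanceLowerBound) ∧
    (_root_.FouriersLaw → MatthiessenLadder.BoundedResponse ∧ JunctionLocality.ConductanceLowerBound) :=
  ⟨fouriersLaw_of_prefixIncrementBounds_of_escapeNonOscillation, fun hF => (pinnedContent_of_fouriersLaw hF).2.2,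
    fun h => ⟨boundedResponse_of_prefixIncrementBounds h, conductanceLowerBound_of_prefixIncrementBounds h⟩,
    fun hF => ⟨(pinnedContent_of_fouriersLaw hF).1, (pinnedContent_of_fouriersLaw hF).2.1⟩⟩

end Summit.AtomisticToContinuum.FouriersLaw.Cruxes.PrefixIncrementBounds.StrategyCensusR1

end
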